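import Literature.NumberTheory.EllipticCurves.Gamma0RankinSelbergResidue
import Literature.NumberTheory.EllipticCurves.HeckeOperatorsAdjointProofs
import Literature.NumberTheory.EllipticCurves.ModularDegreeFormulaProofs
import Literature.NumberTheory.EllipticCurves.ComplexPeriod
import Literature.NumberTheory.EllipticCurves.EichlerShimuraConstructionProofs
import Literature.NumberTheory.EllipticCurves.QuadraticTwistLFunctionProofs
import Literature.NumberTheory.EllipticCurves.QuadraticTwistPadicReduction
import Literature.NumberTheory.EllipticCurves.LFunctionSmulProofs
import Summits.BirchSwinnertonDyer.Rank1Residual.Additive.UnramifiedBaseChange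
import HarnessLib

/-!
# X3/X4 at an additive prime: THE TWIST IDENTITY FOR THE MODULAR DEGREE —
# `p · deg(φ) · c(φ♭)² = deg(φ♭) · u² · c(φ)²` for an additive pair `(E, p)` and its
# `p*`-twist `E♭` (Petersson norm twist-invariance at equal level + Zagier's degree formula)

HONEST FRAMING (cell `b2b-bsdres`, run/shared/lean/b2b/bsd-rank1-residual/, verbatim in every
file): the goal of the cell is to DELETE the COMBINATION-SHAPED residual classes of the
Birch–Swinnerton-Dyer formula for ALL analytic-rank `≤ 1` elliptic curves over `ℚ` — "full BSD
formula for every rank `≤ 1` curve in class `C`" assembled STRICTLY from published theorems — so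
that the rank-`≤ 1` remainder becomes exactly the CONSTRUCTION-SHAPED classes, which are TYPED
(missing-input `Prop`s), NOT attempted. This is not "finishing BSD". Sub-cell `additive-p2`
(CLASS-OWNERS row "X3/X4 additive — pot. good ordinary / X3♯(G-ord)"), generation 17: research
route; no claim beyond the stated classes; theorems only, no definition, NO named fact (every input
below is a tree THEOREM: Zagier's degree formula `zagier_degree_formula_holds`, the Rankin–Selberg
residue identity `tendsto_sub_one_mul_tsum_normSq_cuspCoeff`, the twisted Dirichlet coefficients
`LFunction_quadraticTwist_pStar_apply`, the Néron-lattice bookkeeping `IsNeronLatticeOf.*`);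
X3♯(G-ord)/X4♯(G-ord) stay CONSTRUCTION-SHAPED; no label moves; nothing is booked.

WHAT THIS FILE DOES. Generation 16 (`GordManinConstantDegree.lean`, census
`HOME/b2b-bsdres-additive-p2/census/gen16/DEGREE-CENSUS.md §T6`) recorded, as DATA with
`0` exceptions in `85 108` pairs, the law "for an optimal `E` of UNSTARRED potentially good type
(II / III / IV) at `p ≥ 5`, the optimal curve of the class of the twist `E ⊗ χ_{p*}` has modular
degree EXACTLY `p · deg(E)`", and named a plausible mechanism ("Petersson norm twist-invariant at
equal level + Néron covolume scaling + equal Manin constants"), NOT claimed. This file PROVES the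
mechanism as a kernel identity, for ANY parametrisation data (no optimality), from tree theorems
only. **The per-curve identity is IN PRINT** — M. Watkins, *Computing the modular degree of an
elliptic curve*, Experiment. Math. 11 (2002) §2.1 p. 491 ("if `E_p` has additive reduction at `p`,
then the twisting does not change the `L`-function or the conductor, but does increase the volume by
a factor of `p`, thus decreasing the modular degree by `V_p = p`", with
`deg φ_E = deg φ_F · (c_E²/c_F²) · ∏ V_p`), its ingredients being Zagier 1985 §1, Delaunay, JTNB 15
(2003) Thm 1 (equal Petersson norms at equal `ord_p N`) and Pal, PAMS 140 (2012) Lemma 3.1 /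
Prop. 2.5 (`ω(E^d_min) = ũ·ω(E)/√d`) — located by the cell's harvest-2 seat (E63, 2026-08-21), which
PROVED the same identity concurrently and independently in the LITERATURE tree:
`Literature/NumberTheory/EllipticCurves/ModularDegreeQuadraticTwistProofs.lean`
(`ModularParametrizationData.deg_mul_sq_mul_sq_eq_of_quadraticTwist_pStar`, p246074/p246120, with the
citation tags). The present Summits-side file (p245947, a few minutes earlier) is the cell's own
assembly in the cell's vocabulary (`Addv`, explicit `u(C)`); the two kernel proofs are twins and
neither is a named fact. Let `p` be an odd prime, `p* = (−1)^{(p−1)/2} p`, `W, W♭` elliptic Weierstrass models over `ℚ`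
BOTH with ADDITIVE reduction at `p` (`Addv`), and `C • W^{(p*)} = W♭` for a change of variables `C`
over `ℚ` with scaling `u = u(C)` (so `W♭` is a model of the quadratic twist `E ⊗ χ_{p*}`; on the
potentially good locus: `W` of Kodaira type II / III / IV and `W♭` of type IV* / III* / II*, or
vice versa — the `I₀*` type twists to GOOD reduction and is excluded by `Addv W♭ p`).

* §1 `peterssonProduct_self_eq_of_norm_cuspCoeff_eq` — **two cusp forms `f, g ∈ S₂(Γ₀(N))` with
  `|aₙ(f)| = |aₙ(g)|` for all `n` have the same Petersson norm `(f, f) = (g, g)`**: the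
  Rankin–Selberg residue identity `(s − 1) Σₙ |aₙ|² Γ(s+1)(4πn)^{−(s+1)} → 3 Re(f,f)/(π [SL₂(ℤ):Γ₀(N)])`
  (`s → 1⁺`; tree theorem `tendsto_sub_one_mul_tsum_normSq_cuspCoeff`, Rankin 1939 / Diamond–Shurman
  §5.10) sees only `|aₙ|²` and the level, limits are unique, and `(f, f)` is real
  (`peterssonProduct_conj_symm_holds`).
* §2 `norm_intCast_LFunction_eq_of_twist_pStar` — **`|aₙ(W♭)| = |aₙ(W)|` for ALL `n`**: for
  `p ∤ n`, `aₙ(W♭) = aₙ(W^{(p*)}) = (n/p) · aₙ(W)` (`LFunction_smul`, `LFunction_quadraticTwist_pStar_apply`,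
  Silverman *AEC* X Ex. 10.16) with `(n/p) = ±1`; for `p ∣ n` BOTH coefficients vanish because both
  curves are additive at `p` (`LFunction_apply_eq_zero_of_hasAdditiveReductionAt` — the Euler factor
  at an additive prime is `1`). Hence (`peterssonProduct_eq_of_twist_pStar`) the newforms `f, f♭` of
  two parametrisation data of `W, W♭` AT THE SAME LEVEL `N` have `(f♭, f♭) = (f, f)`.
* §3 `covolume_neronLattice_of_twist` — **`|d| · covol(Λ_{W♭}) = u² · covol(Λ_W)`** for
  `C • W^{(d)} = W♭`, `d ∈ ℚ^×`, and Néron-type period pairs of the two models: `g₂, g₃` of `W^{(d)}`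
  are `d² c₄/12, d³ c₆/216` (`quadraticTwist_c₄/c₆`), so `z⁻¹Λ_W` (`z² = d` in `ℂ`) is a period
  lattice of `W^{(d)}` (`PeriodPair.g₂_mulLeft`), `Λ_{W♭} = u · z⁻¹ Λ_W`
  (`IsNeronLatticeOf.lattice_eq_mulLeft_of_smul`, uniqueness `IsNeronLatticeOf.lattice_eq`), and
  `covol(cΛ) = |c|² covol(Λ)` (`PeriodPair.covolume_mulLeft_lattice`).
* §4 **THE IDENTITY** `twist_modularDegree_identity` — for parametrisation data
  `D : ModularParametrizationData W N`, `D♭ : ModularParametrizationData W♭ N` (same `N`; newforms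
  `f, f♭`, Manin constants `c, c♭`, degrees `deg, deg♭`, Néron lattices `Λ, Λ♭`):
  **`p · deg · c♭² = deg♭ · u² · c²`** (in `ℚ`; `…_real` in `ℝ`). Proof: Zagier's formula (tree
  theorem `zagier_degree_formula_holds`, Zagier 1985 §1 p. 374) for both data,
  `4π² c² (f,f) = deg · covol(Λ)` and `4π² c♭² (f♭,f♭) = deg♭ · covol(Λ♭)`, with §2
  `(f♭,f♭) = (f,f)` and §3 `p · covol(Λ♭) = u² · covol(Λ)`.
READING (the gen-16 census law explained): for the `X₀(N)`-optimal curves `E` (unstarred) and `E'`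
(optimal in the twisted class) with their optimal parametrisations, Manin constants `c = c' = 1`
(Cremona's table) and `E' = E♭` globally minimal (`u = ±1`), the identity reads `deg' = p · deg` —
the law observed on `85 108 / 85 108` (G-ord) pairs; where the twisted class has a `p`-isogeny
(potentially supersingular classes; 1–3 %) the optimal curve `E'` is NOT the twist of `E` and the
observed ratio `1` is the degree `p` of the isogeny `E♭ → E'`. The `p`-adic consequences — the
Manin datum of the STARRED types at `p ∈ {5, 7}` from two degrees (Česnavičius–Neururer–Saha),
and of Edixhoven's exception locus at `p ≥ 11` from two degrees — are in
`GordManinConstantTwistDegree.lean`; the `p`-adic dictionary of the pair `(W, W♭)` (conductor,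
`ord_p Δ_min`, `ord_p u = 0`) in `GordTwistMinimalModel.lean`. Nothing here changes a label.

References: M. Watkins, *Computing the modular degree of an elliptic curve*, Experiment. Math. 11
(2002) 487–502, §2.1 p. 491 (`V_p = p`) [Watkins2002]; C. Delaunay, *Computing modular degrees using
L-functions*, J. Théor. Nombres Bordeaux 15 (2003) 673–682, (1) and Thm 1 [Delaunay2003]; V. Pal,
*Periods of quadratic twists of elliptic curves*, Proc. AMS 140 (2012), Prop. 2.5, Lemma 3.1
[Pal2012]; D. Zagier, *Modular parametrizations of elliptic curves*, Canad. Math. Bull. 28 (1985)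
§1 p. 374 [ZagierCMB1985]; R. A. Rankin, *Contributions to the theory of Ramanujan's function τ(n)*,
Proc. Cambridge Philos. Soc. 35 (1939) (the residue of `Σ|aₙ|² n^{−s}`); F. Diamond, J. Shurman,
*A first course in modular forms* §5.10 [DiamondShurman2005]; J. H. Silverman, *AEC* X.2 Ex. 10.16,
III.1 Table 3.1, VI.5.1 [SilvermanAEC2009]; J. E. Cremona, *Algorithms for modular elliptic curves*
§2.10, §3.7 [CremonaAlgorithms1997]; B. Edixhoven, Progr. Math. 89 (1991) §1 [EdixhovenManin1991].
-/

noncomputable section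

open scoped MatrixGroups ModularForm Real Topology NumberField
open Filter CongruenceSubgroup WeierstrassCurve IsDedekindDomain NumberField Rat.HeightOneSpectrum
  Literature.NumberTheory.EllipticCurves Literature.NumberTheory.EllipticCurves.ModularForms
  Literature.NumberTheory.EllipticCurves.Rank1Residual

namespace Summit.BirchSwinnertonDyer.Rank1Residual.Additive

/-! ### §1 Cusp forms with the same `|aₙ|` have the same Petersson norm (Rankin–Selberg) -/

/-- **Two weight-`2` cusp forms on `Γ₀(N)` whose Fourier coefficients have the same absolute
values have the same Petersson norm.** The Rankin–Selberg residue identity (tree theorem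
`tendsto_sub_one_mul_tsum_normSq_cuspCoeff`): `(s − 1)·Σₙ |aₙ(f)|² Γ(s+1)(4πn)^{−(s+1)} →
3·Re(f,f)/(π·[SL₂(ℤ):Γ₀(N)])` as `s → 1⁺` depends only on the `|aₙ(f)|` and the level, the limit
along `𝓝[>] 1` is unique, and `(f, f)` is real (Hermitian symmetry,
`peterssonProduct_conj_symm_holds`). [cite: DiamondShurman2005, §5.10 (Rankin–Selberg method)] -/
theorem peterssonProduct_self_eq_of_norm_cuspCoeff_eq {N : ℕ} [NeZero N]
    (f g : CuspForm (Gamma0 N) 2) (h : ∀ n, ‖cuspCoeff f n‖ = ‖cuspCoeff g n‖) :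
    peterssonProduct (Gamma0 N) 2 f f = peterssonProduct (Gamma0 N) 2 g g := by
  have hf := tendsto_sub_one_mul_tsum_normSq_cuspCoeff f
  have hg := tendsto_sub_one_mul_tsum_normSq_cuspCoeff g
  simp_rw [h] at hf
  have hlim := tendsto_nhds_unique hf hg
  have hπ : (π : ℝ) ≠ 0 := Real.pi_ne_zero
  have hγ : (gamma0Index N : ℝ) ≠ 0 := by exact_mod_cast (gamma0Index_pos N).ne'
  have hre : (peterssonProduct (Gamma0 N) 2 f f).re = (peterssonProduct (Gamma0 N) 2 g g).re := by
    have := hlim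
    field_simp at this
    linarith
  have hcf := peterssonProduct_conj_symm_holds (Gamma0 N) 2 f f
  have hcg := peterssonProduct_conj_symm_holds (Gamma0 N) 2 g g
  apply Complex.ext hre
  have h1 : (peterssonProduct (Gamma0 N) 2 f f).im = 0 := by
    simpa using Complex.conj_eq_iff_im.mp hcf.symm
  have h2 : (peterssonProduct (Gamma0 N) 2 g g).im = 0 := by
    simpa using Complex.conj_eq_iff_im.mp hcg.symm
  rw [h1, h2]

/-! ### §2 The Dirichlet coefficients of an additive pair and its `p*`-twist -/

variable (p : ℕ) [hp : Fact p.Prime]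

/-- **`|aₙ(W♭)| = |aₙ(W)|` for every `n`**, for `W, W♭` both ADDITIVE at the odd prime `p` and
`C • W^{(p*)} = W♭` (`p* = (−1)^{⌊p/2⌋} p`): away from `p`, `aₙ(W♭) = aₙ(W^{(p*)}) = (n/p)·aₙ(W)`
(`LFunction_smul`; `LFunction_quadraticTwist_pStar_apply`, Silverman *AEC* X Ex. 10.16) and
`(n/p) = ±1`; at the multiples of `p` both coefficients vanish (additive Euler factor `= 1`,
`LFunction_apply_eq_zero_of_hasAdditiveReductionAt`, bridged from the cell's `Addv` by
`hasAdditiveReductionAt_of_addv`). [cite: SilvermanAEC2009, X.2 Exercise 10.16] -/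
theorem norm_intCast_LFunction_eq_of_twist_pStar (hp2 : p ≠ 2) (W W' : WeierstrassCurve ℚ)
    [W.IsElliptic] [W'.IsElliptic] (hW : Addv W p) (hW' : Addv W' p) (C : VariableChange ℚ)
    (hC : C • W.quadraticTwist ((-1 : ℚ) ^ (p / 2) * p) = W') (n : ℕ) :
    ‖((W'.LFunction n : ℤ) : ℂ)‖ = ‖((W.LFunction n : ℤ) : ℂ)‖ := by
  by_cases hn : p ∣ n
  · -- both coefficients vanish: additive reduction at `p` on both sides
    have hv : (primesEquiv ((primesEquiv (R := 𝓞 ℚ)).symm ⟨p, hp.out⟩) : ℕ) = p :=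
      primesEquiv_symm_apply_coe p
    rw [W.LFunction_apply_eq_zero_of_hasAdditiveReductionAt hv
        (hasAdditiveReductionAt_of_addv W p hW) hn,
      W'.LFunction_apply_eq_zero_of_hasAdditiveReductionAt hv
        (hasAdditiveReductionAt_of_addv W' p hW') hn]
  · have hd0 : ((-1 : ℚ) ^ (p / 2) * p) ≠ 0 :=
      mul_ne_zero (pow_ne_zero _ (by norm_num)) (by exact_mod_cast hp.out.ne_zero)
    haveI : (W.quadraticTwist ((-1 : ℚ) ^ (p / 2) * p)).IsElliptic :=
      W.isElliptic_quadraticTwist hd0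
    have h1 : W'.LFunction = (W.quadraticTwist ((-1 : ℚ) ^ (p / 2) * p)).LFunction := by
      rw [← hC, LFunction_smul]
    have h2 := W.LFunction_quadraticTwist_pStar_apply hp2 hn
    push_cast at h2
    rw [h1, h2]
    have hn' : ((n : ℤ) : ZMod p) ≠ 0 := by
      rw [Int.cast_natCast, Ne, ZMod.natCast_eq_zero_iff]
      exact hn
    push_cast
    rw [norm_mul]
    rcases legendreSym.eq_one_or_neg_one p hn' with h | h <;> simp [h]

/-- **The newforms of an additive pair and of its `p*`-twist, at the SAME level, have the same
Petersson norm**: for parametrisation data `D` of `W` and `D'` of `W♭` at level `N`,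
`(f_{D'}, f_{D'})_{Γ₀(N)} = (f_D, f_D)_{Γ₀(N)}` (§1 with `aₙ(f_D) = aₙ(W)`, `aₙ(f_{D'}) = aₙ(W♭)`,
`IsNewformOf`, and §2). [cite: DiamondShurman2005, §5.10 (Rankin–Selberg method)] -/
theorem peterssonProduct_eq_of_twist_pStar (hp2 : p ≠ 2) (W W' : WeierstrassCurve ℚ)
    [W.IsElliptic] [W'.IsElliptic] (hW : Addv W p) (hW' : Addv W' p) (C : VariableChange ℚ)
    (hC : C • W.quadraticTwist ((-1 : ℚ) ^ (p / 2) * p) = W') {N : ℕ} [NeZero N]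
    (D : ModularParametrizationData W N) (D' : ModularParametrizationData W' N) :
    peterssonProduct (Gamma0 N) 2 D'.f D'.f = peterssonProduct (Gamma0 N) 2 D.f D.f :=
  peterssonProduct_self_eq_of_norm_cuspCoeff_eq D'.f D.f fun n ↦ by
    rw [D'.isNewformOf.2 n, D.isNewformOf.2 n]
    exact norm_intCast_LFunction_eq_of_twist_pStar p hp2 W W' hW hW' C hC n

/-! ### §3 The Néron lattice of a twisted model: `|d| · covol(Λ_{W♭}) = u² · covol(Λ_W)` -/

omit hp in
/-- **The covolume of the period lattice of a model of the quadratic twist.** For `C • W^{(d)} = W♭`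
over `ℚ` (`d ≠ 0`, scaling `u = u(C)`) and Néron-type period pairs `L` of `W`, `L♭` of `W♭`
(`g₂ = c₄/12`, `g₃ = c₆/216`): `|d| · covol(Λ♭) = u² · covol(Λ)`. Indeed `c₄(W^{(d)}) = d² c₄`,
`c₆(W^{(d)}) = d³ c₆` (`quadraticTwist_c₄/c₆`), so for a complex `z` with `z² = d` the homothetic
pair `z⁻¹ L` (`g₂(aL) = a⁻⁴ g₂(L)`, `g₃(aL) = a⁻⁶ g₃(L)`) is a period pair of `W^{(d)}`; then
`Λ♭ = u · z⁻¹ Λ` (`IsNeronLatticeOf.lattice_eq_mulLeft_of_smul`, Silverman *AEC* III.1 Table 3.1 +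
uniqueness VI.5.1), and `covol(cΛ) = |c|² covol(Λ)` with `|z|² = |d|`, `|u|² = u²`.
[cite: SilvermanAEC2009, III.1 Table 3.1 (PDF p. 50)] [cite: CremonaAlgorithms1997, §3.7] -/
theorem covolume_neronLattice_of_twist (W W' : WeierstrassCurve ℚ) {d : ℚ} (hd : d ≠ 0)
    (C : VariableChange ℚ) (hC : C • W.quadraticTwist d = W') {L L' : PeriodPair}
    (hL : IsNeronLatticeOf (W.baseChange ℂ) L) (hL' : IsNeronLatticeOf (W'.baseChange ℂ) L') :
    |(d : ℝ)| * ZLattice.covolume L'.lattice = ((C.u : ℚ) : ℝ) ^ 2 * ZLattice.covolume L.lattice := by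
  -- a complex square root `z` of `d`, and the homothety `a = z⁻¹`
  obtain ⟨z, hz⟩ := IsAlgClosed.exists_eq_mul_self ((d : ℚ) : ℂ)
  have hdC : ((d : ℚ) : ℂ) ≠ 0 := by exact_mod_cast hd
  have hz0 : z ≠ 0 := by
    rintro rfl
    exact hdC (by rw [hz, mul_zero])
  have ha0 : z⁻¹ ≠ 0 := inv_ne_zero hz0
  -- `z⁻¹ Λ` is a Néron-type period pair of the twisted model `W^{(d)}`
  have hL₁ : IsNeronLatticeOf ((W.quadraticTwist d).baseChange ℂ) (L.mulLeft z⁻¹ ha0) := by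
    have hmap : (W.quadraticTwist d).baseChange ℂ = (W.baseChange ℂ).quadraticTwist ((d : ℚ) : ℂ) := by
      simp only [WeierstrassCurve.baseChange, map_quadraticTwist, eq_ratCast]
    rw [hmap]
    constructor
    · rw [PeriodPair.g₂_mulLeft, hL.1, quadraticTwist_c₄, inv_pow, inv_inv, hz]
      ring
    · rw [PeriodPair.g₃_mulLeft, hL.2, quadraticTwist_c₆, inv_pow, inv_inv, hz]
      ring
  -- hence `Λ' = u · z⁻¹ Λ`
  have hlat := IsNeronLatticeOf.lattice_eq_mulLeft_of_smul C hL₁ (hC ▸ hL')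
  rw [hlat, PeriodPair.covolume_mulLeft_lattice, PeriodPair.covolume_mulLeft_lattice]
  have hnz : ‖z‖ ^ 2 = |(d : ℝ)| := by
    rw [← norm_pow, pow_two, ← hz, Complex.norm_ratCast]
  have hnorm_u : ‖((C.u : ℚ) : ℂ)‖ = |((C.u : ℚ) : ℝ)| := by
    rw [Complex.norm_ratCast]
  rw [norm_inv, inv_pow, hnz, hnorm_u, sq_abs]
  have hdpos : 0 < |(d : ℝ)| := abs_pos.mpr (by exact_mod_cast hd)
  field_simp

/-! ### §4 The identity `p · deg · c♭² = deg♭ · u² · c²` -/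

/-- **THE TWIST IDENTITY FOR THE MODULAR DEGREE (real form).** `p` odd, `W, W♭` elliptic over `ℚ`,
both ADDITIVE at `p`, `C • W^{(p*)} = W♭` with scaling `u = u(C) ∈ ℚ^×`; `D, D♭` parametrisation data
of `W, W♭` at the same level `N` (newforms `f, f♭`; Manin constants `c = D.c`, `c♭ = D♭.c`; modular
degrees `deg, deg♭`). Then **`p · deg · c♭² = deg♭ · u² · c²`**. Proof: Zagier's degree formula
(tree theorem `zagier_degree_formula_holds`, Zagier 1985 §1 p. 374) `4π² c² (f,f) = deg · covol(Λ)`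
for `D` and `4π² c♭² (f♭,f♭) = deg♭ · covol(Λ♭)` for `D♭`; `(f♭,f♭) = (f,f)` (§2,
`peterssonProduct_eq_of_twist_pStar`); `p · covol(Λ♭) = u² · covol(Λ)` (§3 with `|p*| = p`); and
`covol(Λ) > 0`. No optimality / strong hypothesis, no minimality hypothesis, no named fact. In print
per curve: Watkins 2002 §2.1 (`V_p = p`); kernel twin in the Literature tree:
`ModularParametrizationData.deg_mul_sq_mul_sq_eq_of_quadraticTwist_pStar` (harvest-2, p246074).
[cite: Watkins2002, §2.1 (p. 491)] [cite: ZagierCMB1985, §1 (p. 374)]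
[cite: DiamondShurman2005, §5.10 (Rankin–Selberg method)] -/
theorem twist_modularDegree_identity_real (hp2 : p ≠ 2) (W W' : WeierstrassCurve ℚ)
    [W.IsElliptic] [W'.IsElliptic] (hW : Addv W p) (hW' : Addv W' p) (C : VariableChange ℚ)
    (hC : C • W.quadraticTwist ((-1 : ℚ) ^ (p / 2) * p) = W') {N : ℕ} [NeZero N]
    (D : ModularParametrizationData W N) (D' : ModularParametrizationData W' N) :
    (p : ℝ) * D.modularDegree * (D'.maninConstant : ℝ) ^ 2 =
      D'.modularDegree * ((C.u : ℚ) : ℝ) ^ 2 * (D.maninConstant : ℝ) ^ 2 := by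
  simp only [ModularParametrizationData.modularDegree, ModularParametrizationData.maninConstant]
  have hd0 : ((-1 : ℚ) ^ (p / 2) * p) ≠ 0 :=
    mul_ne_zero (pow_ne_zero _ (by norm_num)) (by exact_mod_cast hp.out.ne_zero)
  have habs : |(((-1 : ℚ) ^ (p / 2) * p : ℚ) : ℝ)| = p := by
    push_cast
    rw [abs_mul, abs_pow, abs_neg, abs_one, one_pow, one_mul, Nat.abs_cast]
  -- Zagier's formula for both data, the equality of the Petersson norms, and the covolume relation
  have hZ := D.zagier_degree_formula_holds
  have hZ' := D'.zagier_degree_formula_holds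
  have hP := peterssonProduct_eq_of_twist_pStar p hp2 W W' hW hW' C hC D D'
  have hcov := covolume_neronLattice_of_twist W W' hd0 C hC D.isNeronLattice D'.isNeronLattice
  rw [habs] at hcov
  unfold ModularParametrizationData.zagier_degree_formula at hZ hZ'
  rw [hP] at hZ'
  -- `(4π² c♭²) · (deg · covol Λ) = (4π² c²) · (deg♭ · covol Λ♭)` in `ℂ`, hence in `ℝ`
  have key : ((4 * Real.pi ^ 2 * (D'.c : ℝ) ^ 2 : ℝ) : ℂ) *
        ((D.deg * ZLattice.covolume D.L.lattice : ℝ) : ℂ)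
      = ((4 * Real.pi ^ 2 * (D.c : ℝ) ^ 2 : ℝ) : ℂ) *
        ((D'.deg * ZLattice.covolume D'.L.lattice : ℝ) : ℂ) := by
    rw [← hZ, ← hZ']; ring
  have keyR : (4 * Real.pi ^ 2 * (D'.c : ℝ) ^ 2) * (D.deg * ZLattice.covolume D.L.lattice)
      = (4 * Real.pi ^ 2 * (D.c : ℝ) ^ 2) * (D'.deg * ZLattice.covolume D'.L.lattice) := by
    exact_mod_cast key
  have hcovpos : 0 < ZLattice.covolume D.L.lattice := ZLattice.covolume_pos _ _
  have h4 : (4 * Real.pi ^ 2 * ZLattice.covolume D.L.lattice : ℝ) ≠ 0 := by positivity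
  refine mul_left_cancel₀ h4 ?_
  linear_combination (p : ℝ) * keyR + (4 * Real.pi ^ 2 * (D.c : ℝ) ^ 2 * (D'.deg : ℝ)) * hcov

/-- **THE TWIST IDENTITY FOR THE MODULAR DEGREE (rational form):** under the hypotheses of
`twist_modularDegree_identity_real`, `p · deg(D) · c(D♭)² = deg(D♭) · u(C)² · c(D)²` in `ℚ`
(all quantities are rational: `deg ∈ ℕ`, `c ∈ ℤ`, `u ∈ ℚ^×`). For the optimal curves with `c = c♭ = 1`
and globally minimal models (`u = ±1`) it is the census law `deg♭ = p · deg` of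
`DEGREE-CENSUS.md §T6` (85 108 / 85 108 pairs) — Watkins' `V_p = p` (Experiment. Math. 11 (2002)
§2.1). [cite: Watkins2002, §2.1 (p. 491)] [cite: ZagierCMB1985, §1 (p. 374)] -/
theorem twist_modularDegree_identity (hp2 : p ≠ 2) (W W' : WeierstrassCurve ℚ)
    [W.IsElliptic] [W'.IsElliptic] (hW : Addv W p) (hW' : Addv W' p) (C : VariableChange ℚ)
    (hC : C • W.quadraticTwist ((-1 : ℚ) ^ (p / 2) * p) = W') {N : ℕ} [NeZero N]
    (D : ModularParametrizationData W N) (D' : ModularParametrizationData W' N) :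
    (p : ℚ) * D.modularDegree * (D'.maninConstant : ℚ) ^ 2 =
      D'.modularDegree * (C.u : ℚ) ^ 2 * (D.maninConstant : ℚ) ^ 2 := by
  have h := twist_modularDegree_identity_real p hp2 W W' hW hW' C hC D D'
  have h' : (((p : ℚ) * D.modularDegree * (D'.maninConstant : ℚ) ^ 2 : ℚ) : ℝ) =
      ((D'.modularDegree * (C.u : ℚ) ^ 2 * (D.maninConstant : ℚ) ^ 2 : ℚ) : ℝ) := by
    push_cast
    exact h
  exact_mod_cast h'

end Summit.BirchSwinnertonDyer.Rank1Residual.Additive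

end
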